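import Summits.NavierStokesRegularity.FluidComputer.OccupationWindowFloor
import Literature.Analysis.FluidPDE.LerayHopfBoundedContinuation

/-!
# Fluid computer — the occupation (clock) floor in every terminal window BY RESTART, from Cheskidov–Dai AS PRINTED

HONEST FRAMING (cell `pub-fluidc`, verbatim): *low prior, high value-of-information experiment on Tao's
machine paradigm; NOT a claim that NS blows up.* Theorem side of the cell; nothing here is evidence of blow-up.

`OccupationWindowFloor` localised the level-occupation CLOCK floor to a terminal window `(t₀, T)` under an explicit
`H¹`-control hypothesis on `[0, t₀]` (Bernstein: quiet high levels), because the house rendering of Cheskidov–Dai's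
criterion (`cheskidov_dai_occupation`) asks for a rapidly decaying datum and cannot be restarted. pub-fluidc-lit's
AS-PRINTED rendering `Literature.Analysis.FluidPDE.cheskidov_dai_occupation_regular` (p359858; Leray–Hopf on `[0,T]`,
`H¹`-regular on `(0,T)`, `limsup_q O_q(T/2,T) ≤ c` ⇒ `H¹`-regular on `(0,T]`; no decay, no classical hypothesis)
survives restarts, so the restart package of `TerminalWindowFloor` now moves the clock floor into EVERY window with no
hypothesis beyond `H¹`-regularity on the open lifespan `(0, T)` ("regular on `(0,T)`", the paper's own standing
assumption). Conditional on that named fact (hypothesis `h`; a published theorem, not proved in the tree):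

* `occupation_floor_lastHalf` — maximal smooth solution, Leray–Hopf from `u 0`, `H¹`-regular on `(0,T)` ⇒
  `c < limsup_q O_q(T/2, T)` (else `H¹`-regular on `(0,T]` and the tree's continuation
  `CirculationFloor.Birth.extension_of_isH1RegularOn_Ioc` contradicts maximality);
* `setLIntegral_Ioo_comp_add_right` — `∫_{(a,b)} f(τ + s) dτ = ∫_{(a+s,b+s)} f` (translation invariance);
* `occupation_floor_window` — for EVERY `t₀ ∈ [0, T)`: `c < limsup_q O_q(t₀, T)`: restart at a good Leray–Hopf time
  `s ∈ (t₀, T)` (`TerminalWindowFloor.exists_restart`; `IsH1RegularOn.comp_add_right` for the translate), apply the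
  last-half floor to the translate, translate back (its last half is `((T+s)/2, T) ⊆ (t₀, T)`);
* `residence_floor_window`, `plain_occupation_floor_window` — the clock in residence form
  `2^q · U_q(t₀,T) · R_q(t₀,T) > c` and in indicator-free form `∫_{(t₀,T)} 2^q ‖Δ̇_q u‖_∞ dt > c`, at infinitely many
  levels, inside every terminal window — the RULING R35 F6 companion `O = k_out · U_out,pk · τ_res` read late, now free
  of the `H¹`-control-by-hand hypothesis of `OccupationWindowFloor`.

0 sorry; every conditional theorem carries `(h : cheskidov_dai_occupation_regular)` explicitly.

## References

* A. Cheskidov, M. Dai, arXiv:1507.06611 = Proc. Edinburgh Math. Soc. (2025), Thm. 1.1, Def. 2.5–2.6. [CheskidovDai2015]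
* J. C. Robinson, J. L. Rodrigo, W. Sadowski, *The Three-Dimensional Navier–Stokes Equations*, CUP 2016, Ch. 8
  (good restarting times). [RobinsonRodrigoSadowski2016]
-/

noncomputable section

open MeasureTheory Set Function Filter Topology
open scoped ENNReal NNReal
open Literature.Analysis.FluidPDE Literature.Analysis.FunctionSpaces
open Summit.NavierStokesRegularity.FluidComputer.TerminalWindowFloor
open Summit.NavierStokesRegularity.FluidComputer.OccupationWindowFloor
open Summit.NavierStokesRegularity.NavierStokesRegularity.Theorems (CirculationFloor.Birth.extension_of_isH1RegularOn_Ioc)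

namespace Summit.NavierStokesRegularity.FluidComputer.OccupationRestartFloor

/-- **The last-half occupation floor of a blow-up, from Cheskidov–Dai as printed.** Conditionally on
`cheskidov_dai_occupation_regular`: there is an absolute `c > 0` such that every maximal smooth solution `(u, p)` of
the unforced Navier–Stokes system on `ℝ³ × [0, T)` (`ν > 0`, finite lifespan `T`), Leray–Hopf from `u 0` and
`H¹`-regular on the open lifespan `(0, T)`, has `c < limsup_q ∫_{(T/2,T)} 1_{2^q ≤ Λ_c(u t)} 2^q ‖Δ̇_q u(t)‖_∞ dt` —
otherwise the criterion makes `u` `H¹`-regular on `(0, T]` and the tree's continuation step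
(`CirculationFloor.Birth.extension_of_isH1RegularOn_Ioc`) extends it past `T`. [cite: CheskidovDai2015, §1 Thm. 1.1] -/
theorem occupation_floor_lastHalf (h : cheskidov_dai_occupation_regular) :
    ∃ c : ℝ, 0 < c ∧ ∀ (ν T : ℝ), 0 < ν → 0 < T →
      ∀ (u : ℝ → EuclideanSpace ℝ (Fin 3) → EuclideanSpace ℝ (Fin 3)) (p : ℝ → EuclideanSpace ℝ (Fin 3) → ℝ),
      IsMaximalSmoothSolution ν 0 u p T → IsLerayHopfOn T ν 0 (u 0) u → IsH1RegularOn (Ioo 0 T) u →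
      ENNReal.ofReal c < limsup (fun q : ℕ => ∫⁻ τ in Ioo (T / 2) T,
          {τ | (2 : ℝ≥0∞) ^ q ≤ dissipationWavenumber c ν (u τ)}.indicator
            (fun τ => (2 : ℝ≥0∞) ^ q * eLpNorm (blockFn (q : ℤ) (u τ)) ∞ volume) τ) atTop := by
  obtain ⟨c, hc, H⟩ := h
  refine ⟨c, hc, fun ν T hν hT u p hmax hLH hH1 => ?_⟩
  by_contra hle
  have hreg : IsH1RegularOn (Ioc 0 T) u := H ν T hν hT (u 0) u hLH hH1 (not_lt.1 hle)
  exact hmax.2 (CirculationFloor.Birth.extension_of_isH1RegularOn_Ioc hν hT hmax.1 hLH hreg)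

/-- Translation of a lower integral over an open interval: `∫_{(a,b)} f(τ + s) dτ = ∫_{(a+s, b+s)} f(τ) dτ`
(translation invariance of Lebesgue measure). [folklore] -/
theorem setLIntegral_Ioo_comp_add_right (f : ℝ → ℝ≥0∞) (a b s : ℝ) :
    ∫⁻ τ in Ioo a b, f (τ + s) = ∫⁻ τ in Ioo (a + s) (b + s), f τ := by
  rw [← lintegral_indicator measurableSet_Ioo, ← lintegral_indicator measurableSet_Ioo,
    ← lintegral_add_right_eq_self (fun τ => (Ioo (a + s) (b + s)).indicator f τ) s]
  refine lintegral_congr fun τ => ?_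
  by_cases hτ : τ ∈ Ioo a b
  · have hτ' : τ + s ∈ Ioo (a + s) (b + s) := ⟨by linarith [hτ.1], by linarith [hτ.2]⟩
    rw [Set.indicator_of_mem hτ, Set.indicator_of_mem hτ']
  · have hτ' : τ + s ∉ Ioo (a + s) (b + s) := fun h' => hτ ⟨by linarith [h'.1], by linarith [h'.2]⟩
    rw [Set.indicator_of_notMem hτ, Set.indicator_of_notMem hτ']

/-- The last half of a restarted life span lies inside the terminal window it was restarted in:
`∫_{((T-s)/2, T-s)} F(τ + s) dτ ≤ ∫_{(t₀, T)} F` for `t₀ < s < T`. [folklore] -/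
theorem lintegral_lastHalf_translate_le (F : ℝ → ℝ≥0∞) {t₀ s T : ℝ} (hs : t₀ < s) (hsT : s < T) :
    ∫⁻ τ in Ioo ((T - s) / 2) (T - s), F (τ + s) ≤ ∫⁻ τ in Ioo t₀ T, F τ := by
  rw [setLIntegral_Ioo_comp_add_right]
  exact lintegral_mono_set (Ioo_subset_Ioo (by linarith) (by linarith))

/-- **The occupation (clock) floor inside EVERY terminal window, by restart.** Conditionally on
`cheskidov_dai_occupation_regular`: with the absolute `c > 0` of `occupation_floor_lastHalf`, every maximal smooth
solution `(u, p)` (`ν > 0`, finite lifespan `T`), Leray–Hopf from `u 0`, `H¹`-regular on `(0, T)`, and every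
`t₀ ∈ [0, T)` satisfy `c < limsup_{q → ∞} ∫_{(t₀,T)} 1_{2^q ≤ Λ_c(u t)} 2^q ‖Δ̇_q u(t)‖_∞ dt`. Proof: restart at a good
Leray–Hopf time `s ∈ (t₀, T)` (`TerminalWindowFloor.exists_restart`); the translate is maximal smooth, Leray–Hopf from
its datum and `H¹`-regular on `(0, T - s)` (`IsH1RegularOn.comp_add_right`); its last-half occupation exceeds `c`
(`occupation_floor_lastHalf`) and is at most the occupation of `u` on `(t₀, T) ⊇ ((T+s)/2, T)`
(`lintegral_lastHalf_translate_le`). No decay and no `H¹`-control-by-hand hypothesis. [cite: CheskidovDai2015, §1 Thm. 1.1] -/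
theorem occupation_floor_window (h : cheskidov_dai_occupation_regular) :
    ∃ c : ℝ, 0 < c ∧ ∀ (ν T : ℝ), 0 < ν → 0 < T →
      ∀ (u : ℝ → EuclideanSpace ℝ (Fin 3) → EuclideanSpace ℝ (Fin 3)) (p : ℝ → EuclideanSpace ℝ (Fin 3) → ℝ),
      IsMaximalSmoothSolution ν 0 u p T → IsLerayHopfOn T ν 0 (u 0) u → IsH1RegularOn (Ioo 0 T) u →
      ∀ t₀ ∈ Ico 0 T,
      ENNReal.ofReal c < limsup (fun q : ℕ => ∫⁻ τ in Ioo t₀ T,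
          {τ | (2 : ℝ≥0∞) ^ q ≤ dissipationWavenumber c ν (u τ)}.indicator
            (fun τ => (2 : ℝ≥0∞) ^ q * eLpNorm (blockFn (q : ℤ) (u τ)) ∞ volume) τ) atTop := by
  obtain ⟨c, hc, H⟩ := occupation_floor_lastHalf h
  refine ⟨c, hc, fun ν T hν hT u p hmax hLH hH1 t₀ ht₀ => ?_⟩
  obtain ⟨U, hU⟩ := LambdaFrontier.exists_sliceDistribution hLH
  obtain ⟨s, hs, hmaxs, hLHs, -⟩ := exists_restart hν hmax hLH hU ht₀
  have hs0 : 0 < s := ht₀.1.trans_lt hs.1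
  have hH1' : IsH1RegularOn (Ioo s T) u := IsH1RegularOn.mono hH1 (Ioo_subset_Ioo hs0.le le_rfl)
  have hH1s : IsH1RegularOn (Ioo 0 (T - s)) (fun t => u (t + s)) := by
    have h' := IsH1RegularOn.comp_add_right hH1' s
    rwa [sub_self] at h'
  have key := H ν (T - s) hν (sub_pos.2 hs.2) (fun t => u (t + s)) (fun t => p (t + s)) hmaxs hLHs hH1s
  -- abbreviate the occupation integrand of `u`; the translate's integrand is its translate
  set F : ℕ → ℝ → ℝ≥0∞ := fun q τ => {τ | (2 : ℝ≥0∞) ^ q ≤ dissipationWavenumber c ν (u τ)}.indicator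
    (fun τ => (2 : ℝ≥0∞) ^ q * eLpNorm (blockFn (q : ℤ) (u τ)) ∞ volume) τ with hF
  have hFq : ∀ (q : ℕ) (τ : ℝ), F q τ = {τ | (2 : ℝ≥0∞) ^ q ≤ dissipationWavenumber c ν (u τ)}.indicator
      (fun τ => (2 : ℝ≥0∞) ^ q * eLpNorm (blockFn (q : ℤ) (u τ)) ∞ volume) τ := fun q τ => rfl
  have htr : ∀ (q : ℕ) (τ : ℝ), {τ | (2 : ℝ≥0∞) ^ q ≤ dissipationWavenumber c ν ((fun t => u (t + s)) τ)}.indicator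
      (fun τ => (2 : ℝ≥0∞) ^ q * eLpNorm (blockFn (q : ℤ) ((fun t => u (t + s)) τ)) ∞ volume) τ = F q (τ + s) := by
    intro q τ
    by_cases hm : (2 : ℝ≥0∞) ^ q ≤ dissipationWavenumber c ν (u (τ + s))
    · have h1 : τ ∈ {τ | (2 : ℝ≥0∞) ^ q ≤ dissipationWavenumber c ν ((fun t => u (t + s)) τ)} := hm
      have h2 : τ + s ∈ {τ | (2 : ℝ≥0∞) ^ q ≤ dissipationWavenumber c ν (u τ)} := hm
      rw [Set.indicator_of_mem h1, hFq, Set.indicator_of_mem h2]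
    · have h1 : τ ∉ {τ | (2 : ℝ≥0∞) ^ q ≤ dissipationWavenumber c ν ((fun t => u (t + s)) τ)} := hm
      have h2 : τ + s ∉ {τ | (2 : ℝ≥0∞) ^ q ≤ dissipationWavenumber c ν (u τ)} := hm
      rw [Set.indicator_of_notMem h1, hFq, Set.indicator_of_notMem h2]
  refine key.trans_le (limsup_le_limsup (Eventually.of_forall fun q => ?_))
  calc (∫⁻ τ in Ioo ((T - s) / 2) (T - s), {τ | (2 : ℝ≥0∞) ^ q ≤ dissipationWavenumber c ν ((fun t => u (t + s)) τ)}.indicator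
          (fun τ => (2 : ℝ≥0∞) ^ q * eLpNorm (blockFn (q : ℤ) ((fun t => u (t + s)) τ)) ∞ volume) τ)
      = ∫⁻ τ in Ioo ((T - s) / 2) (T - s), F q (τ + s) := lintegral_congr fun τ => htr q τ
    _ ≤ ∫⁻ τ in Ioo t₀ T, F q τ := lintegral_lastHalf_translate_le _ hs.1 hs.2

/-- **The residence (clock) floor inside every terminal window, by restart** (conditional on
`cheskidov_dai_occupation_regular`): in the setting of `occupation_floor_window`, at infinitely many levels `q`
`c < 2^q · (sup_{t ∈ (t₀,T)} ‖Δ̇_q u(t)‖_∞) · |{t ∈ (t₀,T) : Λ_c(u(t)) ≥ 2^q}|` — the front dwells at or above level `q`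
for at least `c` eddy turn-over times inside every terminal window (RULING R35 F6's occupation companion
`O = k_out · U_out,pk · τ_res`, read late; no decay / no by-hand `H¹`-control hypotheses).
[cite: CheskidovDai2015, §1 Thm. 1.1] -/
theorem residence_floor_window (h : cheskidov_dai_occupation_regular) :
    ∃ c : ℝ, 0 < c ∧ ∀ (ν T : ℝ), 0 < ν → 0 < T →
      ∀ (u : ℝ → EuclideanSpace ℝ (Fin 3) → EuclideanSpace ℝ (Fin 3)) (p : ℝ → EuclideanSpace ℝ (Fin 3) → ℝ),
      IsMaximalSmoothSolution ν 0 u p T → IsLerayHopfOn T ν 0 (u 0) u → IsH1RegularOn (Ioo 0 T) u →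
      ∀ t₀ ∈ Ico 0 T,
      ∃ᶠ q : ℕ in atTop, ENNReal.ofReal c <
        (2 : ℝ≥0∞) ^ q * (⨆ τ ∈ Ioo t₀ T, eLpNorm (blockFn (q : ℤ) (u τ)) ∞ volume) *
          volume (Ioo t₀ T ∩ {τ | (2 : ℝ≥0∞) ^ q ≤ dissipationWavenumber c ν (u τ)}) := by
  obtain ⟨c, hc, H⟩ := occupation_floor_window h
  refine ⟨c, hc, fun ν T hν hT u p hmax hLH hH1 t₀ ht₀ => ?_⟩
  exact (frequently_lt_of_lt_limsup (by isBoundedDefault) (H ν T hν hT u p hmax hLH hH1 t₀ ht₀)).mono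
    fun q hq => hq.trans_le (occupation_le_residence_window c ν t₀ T u q)

/-- **The indicator-free clock inside every terminal window, by restart** (conditional on
`cheskidov_dai_occupation_regular`): in the same setting, `∫_{(t₀,T)} 2^q ‖Δ̇_q u(t)‖_∞ dt > c` at infinitely many
levels `q` — wavenumber × level sup-velocity, integrated over any terminal window, exceeds the absolute constant
infinitely often. [cite: CheskidovDai2015, §1 Thm. 1.1] -/
theorem plain_occupation_floor_window (h : cheskidov_dai_occupation_regular) :
    ∃ c : ℝ, 0 < c ∧ ∀ (ν T : ℝ), 0 < ν → 0 < T →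
      ∀ (u : ℝ → EuclideanSpace ℝ (Fin 3) → EuclideanSpace ℝ (Fin 3)) (p : ℝ → EuclideanSpace ℝ (Fin 3) → ℝ),
      IsMaximalSmoothSolution ν 0 u p T → IsLerayHopfOn T ν 0 (u 0) u → IsH1RegularOn (Ioo 0 T) u →
      ∀ t₀ ∈ Ico 0 T,
      ∃ᶠ q : ℕ in atTop, ENNReal.ofReal c < ∫⁻ τ in Ioo t₀ T,
          (2 : ℝ≥0∞) ^ q * eLpNorm (blockFn (q : ℤ) (u τ)) ∞ volume := by
  obtain ⟨c, hc, H⟩ := occupation_floor_window h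
  refine ⟨c, hc, fun ν T hν hT u p hmax hLH hH1 t₀ ht₀ => ?_⟩
  have hlim := (H ν T hν hT u p hmax hLH hH1 t₀ ht₀).trans_le
    (limsup_le_limsup (Eventually.of_forall fun q => lintegral_mono fun τ => Set.indicator_le_self _ _ τ))
  exact frequently_lt_of_lt_limsup (by isBoundedDefault) hlim

end Summit.NavierStokesRegularity.FluidComputer.OccupationRestartFloor

end
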